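/-
Copyright (c) 2026. All rights reserved.
Released under Apache 2.0 license as described in the file LICENSE.
Authors: abc-iut cell, wave-3 discharge seat abc-iut-L6-d2 (gen 2) (the real `GaloisPadicLog` of
abc-iut-L4-t2, [AbsTopIII] Def 3.1 (iv), for EVERY base field `k` of the tower `ℚ_p ⊆ k ⊆ ℚ̄_p`).
-/
import Literature.AnabelianGeometry.AbsoluteAnabelian.GaloisPadicLogInstance
import Mathlib.Analysis.Normed.Group.Ultra
import Mathlib.Algebra.Polynomial.Eval.Degree
import Mathlib.FieldTheory.IntermediateField.Basic
import HarnessLib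

/-!
# [AbsTopIII] Def 3.1 (iv) / [IUTchIII] Def 1.1 (i): the real logarithm `log_k̄` for every base `k ⊆ ℚ̄_p`

S. Mochizuki, *Topics in absolute anabelian geometry III*, J. Math. Sci. Univ. Tokyo 22 (2015)
[MochizukiAbsTopIII2015], Def 3.1 (iv), manuscript p. 66: for an MLF `k` with algebraic closure `k̄`,
"the [`p`-adic, if `k` is of residue characteristic `p`] logarithm determines a `Π_k`-equivariant
isomorphism `log_k̄ : k~ := (𝒪_k̄^×)^pf ⥲ k̄` [where “pf” denotes the perfection …] of the topological
group `k~` onto the additive topological group `k̄`" (p. 66, l. 21–27 of the kurims manuscript).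
This is the codomain of the log-link of [IUTchIII] Def 1.1 (i) (kurims p. 23 l. 44 – p. 24 l. 6:
`Ψ~_{†F_v} := (Ψ^×_{†F_v})^pf`, and "the natural, algorithmically constructible ind-topological field
structure on `Ψ^gp_{†F_v}` allows one to define a `p_v`-adic logarithm on `Ψ~_{†F_v}`, which, in turn,
yields a functorial algorithm in the Frobenioid `†F_v` for constructing an ind-topological field
structure on `Ψ~_{†F_v}`"; paraphrase: `log(†F_v)` is `k~` with the field structure of `k̄`
transported along `log_k̄`).

Seat abc-iut-L4-t2 typed `log_k̄` as the HYPOTHESIS STRUCTURE `GaloisPadicLog k K`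
(`MLFGaloisModel.lean`): a map `log : K → K`, a homomorphism on `𝒪_k̄^× = unitSubmonoid k K`,
`G_k`-equivariant, with kernel on `𝒪_k̄^×` exactly the roots of unity, surjective onto `k̄`. Seat
abc-iut-L3-t11 built the real instance for the ONE base `k = ℚ_p`, `K = ℚ̄_p = PadicAlgCl p`
(`GaloisPadicLog.ofPadicAlgCl`, `GaloisPadicLogInstance.lean`, `log := padicLogAlgCl p`, the tree's
Iwasawa logarithm), noting "a general MLF base `k ⊂ ℚ̄_p` … not done here".

THIS FILE removes that restriction for the whole tower: for ANY field `k` with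
`ℚ_p → k → ℚ̄_p` (`[Algebra ℚ_[p] k] [Algebra k (PadicAlgCl p)] [IsScalarTower ℚ_[p] k (PadicAlgCl p)]`)
and any valuative structure on `k` whose valuation ring is the pull-back of the closed unit ball of
`ℚ̄_p` — in particular for EVERY intermediate field `ℚ_p ⊆ E ⊆ ℚ̄_p` with the valuation of the
`p`-adic absolute value (the literal setting "`k_i ⊆ ℚ̄_p` a finite extension of `ℚ_p`" of
[IUTchIV] Prop 1.1, and more) — the SAME function `padicLogAlgCl p` is a `GaloisPadicLog k (PadicAlgCl p)`:

* `GaloisPadicLog.ofPadicTowerUnits` — the instance from the one set-theoretic input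
  `unitSubmonoid k ℚ̄_p = unitSubmonoid ℚ_p ℚ̄_p` (`𝒪_k̄^×` does not depend on the base: it is the unit
  sphere `{‖x‖ = 1}`); the four axioms are abc-iut-L3-t11's `ℚ_p`-lemmas, the `G_k`-equivariance being
  the `G_{ℚ_p}`-equivariance restricted along `Gal(ℚ̄_p/k) ⊆ Gal(ℚ̄_p/ℚ_p)` (`AlgEquiv.restrictScalars`);
* `unitSubmonoid_tower_eq` — that input, PROVED from `hO : ∀ c, c ∈ 𝒪[k] ↔ ‖c‖_{ℚ̄_p} ≤ 1`:
  `x ∈ ℚ̄_p` is integral over `𝒪_k` iff `‖x‖ ≤ 1` (`→`: ultrametric root bound for a monic polynomial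
  with coefficients of norm `≤ 1`, `norm_le_one_of_monic_of_coeff_norm_le_one`; `←`: integral over
  `𝒪[ℚ_p] = ℤ_p` (abc-iut-L3-t11) and `ℤ_p → 𝒪_k` along the scalar tower), hence
  `𝒪_k̄ = {‖x‖ ≤ 1}`, `𝒪_k̄^× = {‖x‖ = 1}` over `k` as over `ℚ_p`;
* `GaloisPadicLog.ofPadicTower hO` — the instance for such `k`;
* `PadicAlgCl.subfieldValuativeRel E` + `GaloisPadicLog.ofPadicSubfield E` — for an intermediate field
  `E` of `ℚ̄_p/ℚ_p` with the valuative relation of the restricted absolute value (`x ≤ᵥ y ↔ ‖x‖ ≤ ‖y‖`),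
  `hO` HOLDS (`PadicAlgCl.mem_integer_subfield_iff`), so `E` carries the real `GaloisPadicLog E ℚ̄_p`
  with no hypothesis; `GaloisPadicLog.nonempty_padicSubfield`.

Scope (honest): the base is any `k` INSIDE `ℚ̄_p` (given with its embedding); an abstract `MLFClosure`
(`k` with an abstract algebraic closure `K`) needs in addition the transport along `K ≃ₐ[ℚ_p] ℚ̄_p`
and the identification of its valuation ring — not in this file. Classical `p`-adic analysis
(Iwasawa logarithm; Bosch–Güntzer–Remmert 3.1.2/1 for the root bound); the two `def`s are the
valuative relation and the instances; nothing here bears on [IUTchIII] Cor. 3.12; typed ≠ discharged.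
-/

set_option autoImplicit false

noncomputable section

namespace Literature.AnabelianGeometry.AbsoluteAnabelian

open Polynomial ValuativeRel
open scoped ValuativeRel
open Literature.NumberTheory.Transcendental

/-! ## An ultrametric root bound -/

/-- In an ultrametric normed field, a root of a MONIC polynomial all of whose coefficients have norm
`≤ 1` has norm `≤ 1` (if `‖x‖ > 1` the leading term `x^n` strictly dominates every other term).
Bosch–Güntzer–Remmert, *Non-Archimedean Analysis*, 3.1.2 Prop. 1. [cite: MochizukiAbsTopIII2015, Definition 3.1 (i) p.66] -/
theorem norm_le_one_of_monic_of_coeff_norm_le_one {L : Type*} [NormedField L] [IsUltrametricDist L]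
    {f : L[X]} (hf : f.Monic) (hc : ∀ n, ‖f.coeff n‖ ≤ 1) {x : L} (hx : f.eval x = 0) :
    ‖x‖ ≤ 1 := by
  by_contra h
  have hx1 : (1 : ℝ) ≤ ‖x‖ := (not_le.mp h).le
  have hx1' : (1 : ℝ) < ‖x‖ := not_le.mp h
  rcases Nat.eq_zero_or_pos f.natDegree with h0 | hpos
  · -- degree `0`: `f = 1`, no root
    have hf1 : f = 1 := Polynomial.eq_one_of_monic_natDegree_zero hf h0
    rw [hf1, eval_one] at hx
    exact one_ne_zero hx
  · obtain ⟨m, hm⟩ : ∃ m, f.natDegree = m + 1 := ⟨f.natDegree - 1, by omega⟩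
    have hsum := eval_eq_sum_range (p := f) x
    rw [hx, hm, Finset.sum_range_succ, ← hm, hf.coeff_natDegree, one_mul, hm] at hsum
    -- `x^(m+1) = -(∑_{i ≤ m} c_i x^i)`
    have hxm : x ^ (m + 1) = -∑ i ∈ Finset.range (m + 1), f.coeff i * x ^ i := by
      rw [eq_neg_iff_add_eq_zero, add_comm]; exact hsum.symm
    have hbound : ‖x ^ (m + 1)‖ ≤ ‖x‖ ^ m := by
      rw [hxm, norm_neg]
      refine IsUltrametricDist.norm_sum_le_of_forall_le_of_nonneg (pow_nonneg (norm_nonneg x) m) ?_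
      intro i hi
      rw [Finset.mem_range] at hi
      rw [norm_mul, norm_pow]
      calc ‖f.coeff i‖ * ‖x‖ ^ i ≤ 1 * ‖x‖ ^ m :=
            mul_le_mul (hc i) (pow_le_pow_right₀ hx1 (by omega)) (by positivity) zero_le_one
        _ = ‖x‖ ^ m := one_mul _
    rw [norm_pow, pow_succ] at hbound
    have hpos' : 0 < ‖x‖ ^ m := pow_pos (by linarith) m
    nlinarith

/-! ## `𝒪_k̄` and `𝒪_k̄^×` over a base `k` of the tower `ℚ_p ⊆ k ⊆ ℚ̄_p` -/

section Tower

variable (p : ℕ) [hp : Fact p.Prime]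
variable {k : Type} [Field k] [ValuativeRel k] [Algebra ℚ_[p] k] [Algebra k (PadicAlgCl p)]
  [IsScalarTower ℚ_[p] k (PadicAlgCl p)]

omit [Algebra ℚ_[p] k] [IsScalarTower ℚ_[p] k (PadicAlgCl p)] in
/-- `→`: if every element of `𝒪_k` has norm `≤ 1` in `ℚ̄_p`, then an element of `ℚ̄_p` integral over
`𝒪_k` has norm `≤ 1` (root bound for the image of a monic polynomial over `𝒪_k`).
[cite: MochizukiAbsTopIII2015, Definition 3.1 (i) p.66] -/
theorem norm_le_one_of_isIntegral_valuationInteger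
    (hO : ∀ c : k, c ∈ 𝒪[k] → ‖algebraMap k (PadicAlgCl p) c‖ ≤ 1)
    {x : PadicAlgCl p} (hx : IsIntegral 𝒪[k] x) : ‖x‖ ≤ 1 := by
  haveI : IsUltrametricDist (PadicAlgCl p) := IsUltrametricDist.of_normedAlgebra ℚ_[p]
  obtain ⟨f, hf, hfx⟩ := hx
  set g : (PadicAlgCl p)[X] := f.map (algebraMap 𝒪[k] (PadicAlgCl p)) with hg
  have hgm : g.Monic := hf.map _
  have hgx : g.eval x = 0 := by rw [hg, eval_map]; exact hfx
  have hcoef : ∀ n : ℕ, ‖g.coeff n‖ ≤ 1 := fun n => by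
    rw [hg, coeff_map, IsScalarTower.algebraMap_apply 𝒪[k] k (PadicAlgCl p)]
    exact hO _ (f.coeff n).2
  exact norm_le_one_of_monic_of_coeff_norm_le_one hgm hcoef hgx

/-- The map `ℤ_p = 𝒪[ℚ_p] → 𝒪_k` along the scalar tower, available as soon as the elements of `k` of
norm `≤ 1` in `ℚ̄_p` lie in `𝒪_k`. [cite: MochizukiAbsTopIII2015, Definition 3.1 (i) p.66] -/
def valuationIntegerHomOfTower
    (hO : ∀ c : k, ‖algebraMap k (PadicAlgCl p) c‖ ≤ 1 → c ∈ 𝒪[k]) : 𝒪[ℚ_[p]] →+* 𝒪[k] :=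
  ((algebraMap ℚ_[p] k).comp (𝒪[ℚ_[p]]).subtype).codRestrict 𝒪[k] fun c => hO _ (by
    rw [RingHom.comp_apply, ← IsScalarTower.algebraMap_apply ℚ_[p] k (PadicAlgCl p),
      norm_algebraMap']
    exact (Literature.NumberTheory.GaloisRepresentations.Padic.mem_valuationInteger_iff p _).mp c.2)

/-- The map `𝒪[ℚ_p] → 𝒪_k` is compatible with the two structure maps to `ℚ̄_p`.
[cite: MochizukiAbsTopIII2015, Definition 3.1 (i) p.66] -/
theorem algebraMap_comp_valuationIntegerHomOfTower
    (hO : ∀ c : k, ‖algebraMap k (PadicAlgCl p) c‖ ≤ 1 → c ∈ 𝒪[k]) :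
    (algebraMap 𝒪[k] (PadicAlgCl p)).comp (valuationIntegerHomOfTower p hO) =
      (RingHom.id (PadicAlgCl p)).comp (algebraMap 𝒪[ℚ_[p]] (PadicAlgCl p)) := by
  ext c
  rw [RingHom.comp_apply, RingHom.comp_apply, RingHom.id_apply,
    IsScalarTower.algebraMap_apply 𝒪[k] k (PadicAlgCl p),
    IsScalarTower.algebraMap_apply 𝒪[ℚ_[p]] ℚ_[p] (PadicAlgCl p),
    IsScalarTower.algebraMap_apply ℚ_[p] k (PadicAlgCl p)]
  rfl

/-- `←`: if every element of `k` of norm `≤ 1` in `ℚ̄_p` lies in `𝒪_k`, then an element of `ℚ̄_p` of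
norm `≤ 1` is integral over `𝒪_k` (it is integral over `ℤ_p = 𝒪[ℚ_p]`, abc-iut-L3-t11's
`PadicAlgCl.isIntegral_of_norm_le_one`, and `ℤ_p → 𝒪_k`).
[cite: MochizukiAbsTopIII2015, Definition 3.1 (i) p.66] -/
theorem isIntegral_valuationInteger_of_norm_le_one
    (hO : ∀ c : k, ‖algebraMap k (PadicAlgCl p) c‖ ≤ 1 → c ∈ 𝒪[k])
    {x : PadicAlgCl p} (hx : ‖x‖ ≤ 1) : IsIntegral 𝒪[k] x := by
  have h := IsIntegral.map_of_comp_eq (valuationIntegerHomOfTower p hO) (RingHom.id (PadicAlgCl p))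
    (algebraMap_comp_valuationIntegerHomOfTower p hO) (PadicAlgCl.isIntegral_of_norm_le_one hx)
  simpa using h

/-- **`𝒪_k̄ = {‖x‖ ≤ 1}` over any base of the tower**: for `k` with `𝒪_k = {c : ‖c‖_{ℚ̄_p} ≤ 1}`,
abc-iut-L4-t2's `integersClosure k (PadicAlgCl p)` is the closed unit ball.
[cite: MochizukiAbsTopIII2015, Definition 3.1 (i) p.66] -/
theorem mem_integersClosure_tower_iff
    (hO : ∀ c : k, c ∈ 𝒪[k] ↔ ‖algebraMap k (PadicAlgCl p) c‖ ≤ 1) (x : PadicAlgCl p) :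
    x ∈ integersClosure k (PadicAlgCl p) ↔ ‖x‖ ≤ 1 := by
  rw [integersClosure, mem_integralClosure_iff]
  exact ⟨norm_le_one_of_isIntegral_valuationInteger p (fun c hc => (hO c).mp hc),
    isIntegral_valuationInteger_of_norm_le_one p (fun c hc => (hO c).mpr hc)⟩

/-- **`𝒪_k̄^× = {‖x‖ = 1}` over any base of the tower.** [cite: MochizukiAbsTopIII2015, Definition 3.1 (i) p.66] -/
theorem mem_unitSubmonoid_tower_iff
    (hO : ∀ c : k, c ∈ 𝒪[k] ↔ ‖algebraMap k (PadicAlgCl p) c‖ ≤ 1) (x : PadicAlgCl p) :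
    x ∈ unitSubmonoid k (PadicAlgCl p) ↔ ‖x‖ = 1 := by
  constructor
  · rintro ⟨hx, y, hy, hxy⟩
    have h1 : ‖x‖ ≤ 1 := (mem_integersClosure_tower_iff p hO x).mp hx
    have h2 : ‖y‖ ≤ 1 := (mem_integersClosure_tower_iff p hO y).mp hy
    have h12 : ‖x‖ * ‖y‖ = 1 := by rw [← norm_mul, hxy, norm_one]
    exact le_antisymm h1 (by nlinarith [norm_nonneg x, norm_nonneg y])
  · intro hx
    have hx0 : x ≠ 0 := norm_pos_iff.mp (by rw [hx]; exact one_pos)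
    exact ⟨(mem_integersClosure_tower_iff p hO x).mpr hx.le, x⁻¹,
      (mem_integersClosure_tower_iff p hO _).mpr (by rw [norm_inv, hx, inv_one]),
      mul_inv_cancel₀ hx0⟩

/-- `𝒪_k̄^×` does not depend on the base: over `k` it is the same submonoid of `ℚ̄_p` as over `ℚ_p`.
[cite: MochizukiAbsTopIII2015, Definition 3.1 (i) p.66] -/
theorem unitSubmonoid_tower_eq
    (hO : ∀ c : k, c ∈ 𝒪[k] ↔ ‖algebraMap k (PadicAlgCl p) c‖ ≤ 1) :
    unitSubmonoid k (PadicAlgCl p) = unitSubmonoid ℚ_[p] (PadicAlgCl p) := by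
  ext x
  rw [mem_unitSubmonoid_tower_iff p hO, PadicAlgCl.mem_unitSubmonoid_iff]

/-! ## The instance over a base of the tower -/

/-- **The real `log_k̄` over ANY base `k` of `ℚ_p ⊆ k ⊆ ℚ̄_p`**, from the one input
`𝒪_k̄^×(over k) = 𝒪_k̄^×(over ℚ_p)`: `log := padicLogAlgCl p`; the four axioms of abc-iut-L4-t2's
`GaloisPadicLog` are abc-iut-L3-t11's `ℚ_p`-lemmas, the `Gal(ℚ̄_p/k)`-equivariance being the
`Gal(ℚ̄_p/ℚ_p)`-equivariance restricted along `Gal(ℚ̄_p/k) ⊆ Gal(ℚ̄_p/ℚ_p)`.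
[cite: MochizukiAbsTopIII2015, Definition 3.1 (i) p.66] -/
def GaloisPadicLog.ofPadicTowerUnits
    (hU : unitSubmonoid k (PadicAlgCl p) = unitSubmonoid ℚ_[p] (PadicAlgCl p)) :
    GaloisPadicLog k (PadicAlgCl p) where
  log := padicLogAlgCl p
  log_mul x hx y hy :=
    PadicAlgCl.log_mul_of_mem_unitSubmonoid p (by rw [← hU]; exact hx) (by rw [← hU]; exact hy)
  log_smul σ x hx := by
    have h := PadicAlgCl.log_smul_of_mem_unitSubmonoid p (σ.restrictScalars ℚ_[p])
      (by rw [← hU]; exact hx)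
    simpa only [AlgEquiv.smul_def, AlgEquiv.restrictScalars_apply] using h
  log_eq_zero_iff x hx := PadicAlgCl.log_eq_zero_iff_of_mem_unitSubmonoid p (by rw [← hU]; exact hx)
  log_surjective y := by
    obtain ⟨x, hx, hxy⟩ := PadicAlgCl.log_surjective_unitSubmonoid p y
    exact ⟨x, by rw [hU]; exact hx, hxy⟩

/-- The logarithm of the tower instance is the tree's `padicLogAlgCl`.
[cite: MochizukiAbsTopIII2015, Definition 3.1 (i) p.66] -/
@[simp] theorem GaloisPadicLog.ofPadicTowerUnits_log
    (hU : unitSubmonoid k (PadicAlgCl p) = unitSubmonoid ℚ_[p] (PadicAlgCl p)) :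
    (GaloisPadicLog.ofPadicTowerUnits p hU).log = padicLogAlgCl p := rfl

/-- **The real `log_k̄` over a base `k` whose valuation ring is the pull-back of the unit ball of `ℚ̄_p`.**
[cite: MochizukiAbsTopIII2015, Definition 3.1 (i) p.66] -/
def GaloisPadicLog.ofPadicTower
    (hO : ∀ c : k, c ∈ 𝒪[k] ↔ ‖algebraMap k (PadicAlgCl p) c‖ ≤ 1) :
    GaloisPadicLog k (PadicAlgCl p) :=
  GaloisPadicLog.ofPadicTowerUnits p (unitSubmonoid_tower_eq p hO)

/-- The logarithm of `GaloisPadicLog.ofPadicTower` is the tree's `padicLogAlgCl`.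
[cite: MochizukiAbsTopIII2015, Definition 3.1 (i) p.66] -/
@[simp] theorem GaloisPadicLog.ofPadicTower_log
    (hO : ∀ c : k, c ∈ 𝒪[k] ↔ ‖algebraMap k (PadicAlgCl p) c‖ ≤ 1) :
    (GaloisPadicLog.ofPadicTower p hO).log = padicLogAlgCl p := rfl

/-- Non-vacuity over the base `k`: `GaloisPadicLog k ℚ̄_p` is inhabited as soon as
`𝒪_k = {‖·‖_{ℚ̄_p} ≤ 1}`. [cite: MochizukiAbsTopIII2015, Definition 3.1 (i) p.66] -/
theorem GaloisPadicLog.nonempty_ofPadicTower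
    (hO : ∀ c : k, c ∈ 𝒪[k] ↔ ‖algebraMap k (PadicAlgCl p) c‖ ≤ 1) :
    Nonempty (GaloisPadicLog k (PadicAlgCl p)) :=
  ⟨GaloisPadicLog.ofPadicTower p hO⟩

end Tower

/-! ## Every intermediate field `ℚ_p ⊆ E ⊆ ℚ̄_p` -/

section Subfield

variable {p : ℕ} [hp : Fact p.Prime] (E : IntermediateField ℚ_[p] (PadicAlgCl p))

/-- The valuative relation of an intermediate field `E` of `ℚ̄_p / ℚ_p`: that of the restriction of
the `p`-adic absolute value of `ℚ̄_p` (`x ≤ᵥ y ↔ ‖x‖ ≤ ‖y‖`; Mathlib `ValuativeRel.ofValuation` of the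
restricted valuation `Valued.v.comap`). A `def`, not an instance (consumers `letI` it), so as not to
pre-empt other valuative structures on subfields. [cite: MochizukiAbsTopIII2015, Definition 3.1 (i) p.66] -/
@[implicit_reducible]
def PadicAlgCl.subfieldValuativeRel : ValuativeRel E :=
  ValuativeRel.ofValuation ((Valued.v (R := PadicAlgCl p)).comap (algebraMap E (PadicAlgCl p)))

/-- For that valuative relation, `𝒪_E = {x ∈ E : ‖x‖ ≤ 1}` — the hypothesis `hO` of
`GaloisPadicLog.ofPadicTower` HOLDS for `E`. [cite: MochizukiAbsTopIII2015, Definition 3.1 (i) p.66] -/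
theorem PadicAlgCl.mem_integer_subfield_iff (x : E) :
    letI := PadicAlgCl.subfieldValuativeRel E
    x ∈ 𝒪[E] ↔ ‖algebraMap E (PadicAlgCl p) x‖ ≤ 1 := by
  letI := PadicAlgCl.subfieldValuativeRel E
  haveI : ((Valued.v (R := PadicAlgCl p)).comap (algebraMap E (PadicAlgCl p))).Compatible :=
    Valuation.Compatible.ofValuation _
  rw [Valuation.mem_integer_iff, ← Valuation.vle_one_iff (valuation E),
    Valuation.vle_one_iff ((Valued.v (R := PadicAlgCl p)).comap (algebraMap E (PadicAlgCl p))),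
    Valuation.comap_apply, PadicAlgCl.valuation_def, ← NNReal.coe_le_coe, coe_nnnorm, NNReal.coe_one]

/-- **The real `log_k̄` for every intermediate field `ℚ_p ⊆ E ⊆ ℚ̄_p`** (in particular every finite
extension `k_i ⊆ ℚ̄_p` of `ℚ_p`, the setting of [IUTchIV] Prop 1.1 / [IUTchIII] Def 1.1 (i) at
`v ∈ V^non`): `GaloisPadicLog E ℚ̄_p` with `log := padicLogAlgCl p`, no hypothesis.
[cite: MochizukiAbsTopIII2015, Definition 3.1 (i) p.66] -/
def GaloisPadicLog.ofPadicSubfield :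
    @GaloisPadicLog E _ (PadicAlgCl.subfieldValuativeRel E) (PadicAlgCl p) _ _ :=
  letI := PadicAlgCl.subfieldValuativeRel E
  GaloisPadicLog.ofPadicTower p (k := E) (PadicAlgCl.mem_integer_subfield_iff E)

/-- The logarithm of the subfield instance is the tree's `padicLogAlgCl`.
[cite: MochizukiAbsTopIII2015, Definition 3.1 (i) p.66] -/
@[simp] theorem GaloisPadicLog.ofPadicSubfield_log :
    letI := PadicAlgCl.subfieldValuativeRel E
    (GaloisPadicLog.ofPadicSubfield E).log = padicLogAlgCl p := rfl

/-- Over `E`, `𝒪_k̄^× ⊆ ℚ̄_p` is the unit sphere (the same submonoid as over `ℚ_p`).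
[cite: MochizukiAbsTopIII2015, Definition 3.1 (i) p.66] -/
theorem PadicAlgCl.unitSubmonoid_subfield_eq :
    @unitSubmonoid E _ (PadicAlgCl.subfieldValuativeRel E) (PadicAlgCl p) _ _ =
      unitSubmonoid ℚ_[p] (PadicAlgCl p) :=
  letI := PadicAlgCl.subfieldValuativeRel E
  unitSubmonoid_tower_eq p (k := E) (PadicAlgCl.mem_integer_subfield_iff E)

/-- Non-vacuity of abc-iut-L4-t2's interface beyond `k = ℚ_p`: for every intermediate field `E` of
`ℚ̄_p/ℚ_p` (with the valuation of the absolute value), `GaloisPadicLog E ℚ̄_p` is inhabited.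
[cite: MochizukiAbsTopIII2015, Definition 3.1 (i) p.66] -/
theorem GaloisPadicLog.nonempty_padicSubfield :
    Nonempty (@GaloisPadicLog E _ (PadicAlgCl.subfieldValuativeRel E) (PadicAlgCl p) _ _) :=
  ⟨GaloisPadicLog.ofPadicSubfield E⟩

end Subfield

end Literature.AnabelianGeometry.AbsoluteAnabelian

end
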